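import Mathlib
import Summits.CriticalPhenomena.PercolationContinuityZ3.Theses.PercHyperscalingGluing
import Summits.CriticalPhenomena.PercolationContinuityZ3.Theses.PercFiniteBoxLRO
import Summits.CriticalPhenomena.PercolationContinuityZ3.Theorems.PercHyperscalingGluingBoxGluingStubPairFKG
import Summits.CriticalPhenomena.PercolationContinuityZ3.Theorems.PercHyperscalingGluingBoxGluingStubBkSplit
import Summits.CriticalPhenomena.PercolationContinuityZ3.Theorems.PercHyperscalingGluingBoxGluingStubArmPairBK
import Summits.CriticalPhenomena.PercolationContinuityZ3.Theorems.PercHyperscalingGluingBoxGluingOfCritAnnulusNonCrossing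
import HarnessLib

/-!
# Route `PercHyperscalingGluing`, crux `BoxGluing` (stmt-CriticalPhenomena-4643): structure of the crux

Helper file (`--supports stmt-CriticalPhenomena-4643`) of the line lead (c1) of crux `BoxGluing`
(`∃ C > 0, K ≥ 1, ∀ n ≥ 1, π_n² ≤ C |Λ_n|⁻¹ Σ_{x∈Λ_n} τ^{Λ_{Kn}}(0,x)` for bond percolation on `ℤ³` at
`p_c = criticalProbI 3`; `π_n = P(0 ↔ ∂Λ_n)`, `Λ_m = box 3 m`, `τ(0,x) = P(0 ↔ x)`,
`τ^{S}(0,x) = P(0 ↔ x inside S)`).  Pure proof file (no definitions; every statement is an inequality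
between existing percolation quantities, hypotheses inlined).  It records, kernel-checked:

§1 **The exact cut of the crux used by the line's skeleton `Cruxes/BoxGluing/Lines/birth.lean` (r3).**
* `fullSpaceGluing_of_boxGluing` — crux ⟹ FULL-SPACE GLUING `|Λ_n| π_n² ≤ C Σ_{x∈Λ_n} τ(0,x)` (FS; the
  "≤" half of hyperscaling `2/ρ ≥ d − 2 + η` without box restriction).
* `armPairGluing_of_boxGluing` — crux ⟹ ARM-PAIR GLUING `Σ_{x∈Λ_n} P(A_0 ∩ A_x) ≤ C Σ_{x∈Λ_n} τ(0,x)`,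
  `A_y = DCT16.armEvent y n` (FS-arm, the registered stub `stub_armPairGluing`): by the landed BK lemma
  `stub_armPairBK` the Harris step `|Λ_n| π_n² ≤ Σ_x P(A_0 ∩ A_x)` (`stub_pairFKG`) loses nothing.
* `boxRestriction_of_boxGluing` — crux ⟹ BOX RESTRICTION `Σ_{x∈Λ_n} τ(0,x) ≤ C Σ_{x∈Λ_n} τ^{Λ_{Kn}}(0,x)`
  (BR, the registered stub `stub_boxRestriction`), by the landed BK split `stub_bkSplit`.
* `boxGluing_of_armPairGluing_of_boxRestriction`, `boxGluing_iff_armPairGluing_and_boxRestriction` —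
  `BoxGluing ↔ (FS-arm ∧ BR)`: the skeleton's composition `BoxGluing_of` and its converse.  The cut separates
  the `d`-sensitive content (FS-arm: false for `d ≥ 11`, open for `3 ≤ d ≤ 6` — Hutchcroft 2021 p.10,
  Hutchcroft 2025 arXiv:2510.03951 p.8 "only conditional results") from the `d`-robust one (BR: true in
  high `d`, Kozma–Nachmias 2011 restricted two-point estimates).

§2 **What the route's deciding theorem actually consumes.**  `PercHyperscalingGluing.closes` uses `BoxGluing`
only through `θ ≤ π_n`; the statement it needs is JUMP GLUING
`∃ C > 0, K ≥ 1, ∀ n ≥ 1, θ(p_c)² ≤ C |Λ_n|⁻¹ Σ_{x∈Λ_n} τ^{Λ_{Kn}}(0,x)` (hypothesis inlined below), which is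
* implied by the crux (`jumpGluing_of_boxGluing`, `θ ≤ π_n` = `DCT16.theta_le_real_siteToBoundary`),
* VACUOUS in the target world `θ(p_c) = 0` (`jumpGluing_of_theta_eq_zero`),
* implied by Cerf's linear-scale long-range order X_D = `PercFiniteBoxLRO.LinearScaleLROOfTheta`
  (stmt-CriticalPhenomena-0855) at `p = p_c` (`jumpGluing_of_linearScaleLROOfTheta`), and
* sufficient: `percolationContinuityZ3_of_jumpGluing_of_freeBoxShattering` (same bookkeeping as `closes`).
So the `θ(p_c) = 0`-world content of `BoxGluing` — the hyperscaling inequality proper, the open problem — is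
not used by this route's assembly; for `PercolationContinuityZ3` the crux may be weakened to jump gluing
(= an averaged, `p = p_c` form of stmt-0855).  This is a D-0014 observation for the planners, recorded as
theorems; it changes no item.
-/

noncomputable section

namespace Summit.CriticalPhenomena.PercolationContinuityZ3.Theorems

open MeasureTheory Filter Topology
open Literature.Probability.Percolation Literature.Probability.LatticeModels
open Summit.CriticalPhenomena.PercolationContinuityZ3.Theses

namespace BoxGluingStructure

/-- `{0 ↔ x in S}`-sums are dominated by `{0 ↔ x}`-sums. [folklore] -/
theorem sum_openConnIn_le_sum_openConn (S : Set (Site 3)) (T : Finset (Site 3)) :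
    ∑ x ∈ T, (bondPercolation (zdGraph 3) (criticalProbI 3)).real (openConnIn S 0 x) ≤
      ∑ x ∈ T, (bondPercolation (zdGraph 3) (criticalProbI 3)).real (openConn 0 x) :=
  Finset.sum_le_sum fun x _ => measureReal_mono (openConnIn_subset_openConn S 0 x)

/-- Unpacking the crux at one scale: from `a ≤ C |Λ_n|⁻¹ S` to `|Λ_n| a ≤ C S`. [folklore] -/
theorem mul_le_of_le_inv_mul {C a S : ℝ} {n : ℕ} (h : a ≤ C * ((box 3 n).card : ℝ)⁻¹ * S) :
    ((box 3 n).card : ℝ) * a ≤ C * S := by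
  have hcard := FreeBoxSparse.Negative.card_box_pos' n
  have h2 := mul_le_mul_of_nonneg_left h hcard.le
  have h3 : ((box 3 n).card : ℝ) * (C * ((box 3 n).card : ℝ)⁻¹ * S) = C * S := by field_simp
  rwa [h3] at h2

/-- Packing one scale of the crux: from `|Λ_n| a ≤ C S` to `a ≤ C |Λ_n|⁻¹ S`. [folklore] -/
theorem le_inv_mul_of_mul_le {C a S : ℝ} {n : ℕ} (h : ((box 3 n).card : ℝ) * a ≤ C * S) :
    a ≤ C * ((box 3 n).card : ℝ)⁻¹ * S := by
  have hcard := FreeBoxSparse.Negative.card_box_pos' n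
  have : C * ((box 3 n).card : ℝ)⁻¹ * S = ((box 3 n).card : ℝ)⁻¹ * (C * S) := by ring
  rw [this, le_inv_mul_iff₀ hcard]
  exact h

end BoxGluingStructure

open BoxGluingStructure

/-! ## §1 The cut FS-arm × BR of the crux -/

/-- **Crux ⟹ full-space gluing (FS).**  `BoxGluing` gives `C > 0` with
`|Λ_n| · P_{p_c}(0 ↔ ∂Λ_n)² ≤ C · Σ_{x∈Λ_n} P_{p_c}(0 ↔ x)` for all `n ≥ 1` (drop the box restriction:
`τ^{Λ_{Kn}} ≤ τ`).  FS is the exponent-free, box-averaged "≤" half of hyperscaling `2/ρ ≥ d − 2 + η`.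
[folklore] -/
theorem fullSpaceGluing_of_boxGluing (h : PercHyperscalingGluing.BoxGluing) :
    ∃ C : ℝ, 0 < C ∧ ∀ n : ℕ, 1 ≤ n →
      ((box 3 n).card : ℝ) * (bondPercolation (zdGraph 3) (criticalProbI 3)).real (siteToBoundary 3 n) ^ 2 ≤
        C * ∑ x ∈ box 3 n, (bondPercolation (zdGraph 3) (criticalProbI 3)).real (openConn 0 x) := by
  obtain ⟨C, K, hC, _hK, h⟩ := h
  refine ⟨C, hC, fun n hn => (mul_le_of_le_inv_mul (h n hn)).trans ?_⟩
  exact mul_le_mul_of_nonneg_left (sum_openConnIn_le_sum_openConn _ _) hC.le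

/-- **Crux ⟹ arm-pair gluing (FS-arm, the registered stub `stub_armPairGluing` of the line).**
`BoxGluing` gives `C₁ = C + 1` with `Σ_{x∈Λ_n} P_{p_c}(A_0 ∩ A_x) ≤ C₁ · Σ_{x∈Λ_n} P_{p_c}(0 ↔ x)` for all
`n ≥ 1`, `A_y = DCT16.armEvent y n`: the landed BK lemma `stub_armPairBK`
(`P(A_0 ∩ A_x) ≤ π_n² + τ^{Λ_{2n}}(0,x)`) gives `Σ_x P(A_0 ∩ A_x) ≤ |Λ_n| π_n² + Σ_x τ^{Λ_{2n}}(0,x)`, and the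
crux bounds `|Λ_n| π_n²` by `C Σ_x τ^{Λ_{Kn}}(0,x) ≤ C Σ_x τ(0,x)`. [folklore] -/
theorem armPairGluing_of_boxGluing (h : PercHyperscalingGluing.BoxGluing) :
    ∃ C : ℝ, 0 < C ∧ ∀ n : ℕ, 1 ≤ n →
      ∑ x ∈ box 3 n, (bondPercolation (zdGraph 3) (criticalProbI 3)).real
          (DCT16.armEvent 0 n ∩ DCT16.armEvent x n) ≤
        C * ∑ x ∈ box 3 n, (bondPercolation (zdGraph 3) (criticalProbI 3)).real (openConn 0 x) := by
  obtain ⟨C, K, hC, hK, h⟩ := h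
  refine ⟨C + 1, by positivity, fun n hn => ?_⟩
  set P : Measure (BondConfig (Site 3)) := bondPercolation (zdGraph 3) (criticalProbI 3) with hP
  have hBK : ∑ x ∈ box 3 n, P.real (DCT16.armEvent 0 n ∩ DCT16.armEvent x n) ≤
      ((box 3 n).card : ℝ) * P.real (siteToBoundary 3 n) ^ 2 +
        ∑ x ∈ box 3 n, P.real (openConnIn ↑(box 3 (2 * n)) 0 x) := by
    calc ∑ x ∈ box 3 n, P.real (DCT16.armEvent 0 n ∩ DCT16.armEvent x n)
        ≤ ∑ x ∈ box 3 n, (P.real (siteToBoundary 3 n) ^ 2 + P.real (openConnIn ↑(box 3 (2 * n)) 0 x)) :=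
          Finset.sum_le_sum fun x hx => stub_armPairBK n x hx
      _ = ((box 3 n).card : ℝ) * P.real (siteToBoundary 3 n) ^ 2 +
            ∑ x ∈ box 3 n, P.real (openConnIn ↑(box 3 (2 * n)) 0 x) := by
          rw [Finset.sum_add_distrib, Finset.sum_const, nsmul_eq_mul]
  have hBG := mul_le_of_le_inv_mul (h n hn)
  have hS1 := sum_openConnIn_le_sum_openConn (↑(box 3 (K * n))) (box 3 n)
  have hS2 := sum_openConnIn_le_sum_openConn (↑(box 3 (2 * n))) (box 3 n)
  calc ∑ x ∈ box 3 n, P.real (DCT16.armEvent 0 n ∩ DCT16.armEvent x n)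
      ≤ C * ∑ x ∈ box 3 n, P.real (openConnIn ↑(box 3 (K * n)) 0 x) +
          ∑ x ∈ box 3 n, P.real (openConnIn ↑(box 3 (2 * n)) 0 x) := hBK.trans (add_le_add_left hBG _)
    _ ≤ C * ∑ x ∈ box 3 n, P.real (openConn 0 x) + ∑ x ∈ box 3 n, P.real (openConn 0 x) :=
        add_le_add (mul_le_mul_of_nonneg_left hS1 hC.le) hS2
    _ = (C + 1) * ∑ x ∈ box 3 n, P.real (openConn 0 x) := by ring

/-- **Crux ⟹ box restriction (BR, the registered stub `stub_boxRestriction` of the line).**  `BoxGluing`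
with `(C, K)` gives `Σ_{x∈Λ_n} P_{p_c}(0 ↔ x) ≤ (C + 1) · Σ_{x∈Λ_n} P_{p_c}(0 ↔ x inside Λ_{(K+1)n})` for all
`n ≥ 1`: the landed BK split `stub_bkSplit` (`τ(0,x) ≤ τ^{Λ_{(K+1)n}}(0,x) + π_{Kn}²` for `x ∈ Λ_n`) summed
over `Λ_n`, then `|Λ_n| π_{Kn}² ≤ |Λ_n| π_n² ≤ C Σ_x τ^{Λ_{Kn}} ≤ C Σ_x τ^{Λ_{(K+1)n}}`. [folklore] -/
theorem boxRestriction_of_boxGluing (h : PercHyperscalingGluing.BoxGluing) :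
    ∃ C : ℝ, ∃ K : ℕ, 0 < C ∧ 1 ≤ K ∧ ∀ n : ℕ, 1 ≤ n →
      ∑ x ∈ box 3 n, (bondPercolation (zdGraph 3) (criticalProbI 3)).real (openConn 0 x) ≤
        C * ∑ x ∈ box 3 n, (bondPercolation (zdGraph 3) (criticalProbI 3)).real
          (openConnIn ↑(box 3 (K * n)) 0 x) := by
  obtain ⟨C, K, hC, hK, h⟩ := h
  refine ⟨C + 1, K + 1, by positivity, Nat.le_add_left 1 K, fun n hn => ?_⟩
  set P : Measure (BondConfig (Site 3)) := bondPercolation (zdGraph 3) (criticalProbI 3) with hP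
  have hcard : (0 : ℝ) ≤ ((box 3 n).card : ℝ) := Nat.cast_nonneg _
  have hsplit : ∑ x ∈ box 3 n, P.real (openConn 0 x) ≤
      ∑ x ∈ box 3 n, P.real (openConnIn ↑(box 3 ((K + 1) * n)) 0 x) +
        ((box 3 n).card : ℝ) * P.real (siteToBoundary 3 (K * n)) ^ 2 := by
    calc ∑ x ∈ box 3 n, P.real (openConn 0 x)
        ≤ ∑ x ∈ box 3 n, (P.real (openConnIn ↑(box 3 ((K + 1) * n)) 0 x) +
            P.real (siteToBoundary 3 (K * n)) ^ 2) :=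
          Finset.sum_le_sum fun x hx => stub_bkSplit K n x hx
      _ = _ := by rw [Finset.sum_add_distrib, Finset.sum_const, nsmul_eq_mul]
  have h1 : P.real (siteToBoundary 3 (K * n)) ≤ P.real (siteToBoundary 3 n) :=
    DCT16.real_siteToBoundary_antitone _ (Nat.le_mul_of_pos_left n hK)
  have hBG := mul_le_of_le_inv_mul (h n hn)
  have hmono := BoxGluingOfCritAnnulusNonCrossing.sum_openConnIn_mono
    (Nat.mul_le_mul_right n (Nat.le_succ K)) (box 3 n)
  calc ∑ x ∈ box 3 n, P.real (openConn 0 x)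
      ≤ ∑ x ∈ box 3 n, P.real (openConnIn ↑(box 3 ((K + 1) * n)) 0 x) +
          ((box 3 n).card : ℝ) * P.real (siteToBoundary 3 n) ^ 2 :=
        hsplit.trans (add_le_add_right
          (mul_le_mul_of_nonneg_left (pow_le_pow_left₀ measureReal_nonneg h1 2) hcard) _)
    _ ≤ ∑ x ∈ box 3 n, P.real (openConnIn ↑(box 3 ((K + 1) * n)) 0 x) +
          C * ∑ x ∈ box 3 n, P.real (openConnIn ↑(box 3 ((K + 1) * n)) 0 x) :=
        add_le_add_right (hBG.trans (mul_le_mul_of_nonneg_left hmono hC.le)) _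
    _ = (C + 1) * ∑ x ∈ box 3 n, P.real (openConnIn ↑(box 3 ((K + 1) * n)) 0 x) := by ring

/-- **FS-arm ∧ BR ⟹ crux** (the skeleton's composition `BoxGluing_of`, with the landed Harris bound
`stub_pairFKG`): `|Λ_n| π_n² ≤ Σ_x P(A_0 ∩ A_x) ≤ C₁ Σ_x τ(0,x) ≤ C₁ C₂ Σ_x τ^{Λ_{Kn}}(0,x)`, divide by
`|Λ_n| > 0`. [folklore] -/
theorem boxGluing_of_armPairGluing_of_boxRestriction
    (h₁ : ∃ C : ℝ, 0 < C ∧ ∀ n : ℕ, 1 ≤ n →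
      ∑ x ∈ box 3 n, (bondPercolation (zdGraph 3) (criticalProbI 3)).real
          (DCT16.armEvent 0 n ∩ DCT16.armEvent x n) ≤
        C * ∑ x ∈ box 3 n, (bondPercolation (zdGraph 3) (criticalProbI 3)).real (openConn 0 x))
    (h₂ : ∃ C : ℝ, ∃ K : ℕ, 0 < C ∧ 1 ≤ K ∧ ∀ n : ℕ, 1 ≤ n →
      ∑ x ∈ box 3 n, (bondPercolation (zdGraph 3) (criticalProbI 3)).real (openConn 0 x) ≤
        C * ∑ x ∈ box 3 n, (bondPercolation (zdGraph 3) (criticalProbI 3)).real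
          (openConnIn ↑(box 3 (K * n)) 0 x)) :
    PercHyperscalingGluing.BoxGluing := by
  obtain ⟨C₁, hC₁, h₁⟩ := h₁
  obtain ⟨C₂, K, hC₂, hK, h₂⟩ := h₂
  refine ⟨C₁ * C₂, K, mul_pos hC₁ hC₂, hK, fun n hn => le_inv_mul_of_mul_le ?_⟩
  set P : Measure (BondConfig (Site 3)) := bondPercolation (zdGraph 3) (criticalProbI 3) with hP
  calc ((box 3 n).card : ℝ) * P.real (siteToBoundary 3 n) ^ 2
      ≤ ∑ x ∈ box 3 n, P.real (DCT16.armEvent 0 n ∩ DCT16.armEvent x n) := stub_pairFKG n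
    _ ≤ C₁ * ∑ x ∈ box 3 n, P.real (openConn 0 x) := h₁ n hn
    _ ≤ C₁ * (C₂ * ∑ x ∈ box 3 n, P.real (openConnIn ↑(box 3 (K * n)) 0 x)) :=
        mul_le_mul_of_nonneg_left (h₂ n hn) hC₁.le
    _ = C₁ * C₂ * ∑ x ∈ box 3 n, P.real (openConnIn ↑(box 3 (K * n)) 0 x) := by ring

/-- **The line's cut is exact: `BoxGluing ↔ (FS-arm ∧ BR)`.**  Neither conjunct is known to give the crux
alone (FS-arm lacks localisation; BR holds in high `d`, where the crux fails). [folklore] -/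
theorem boxGluing_iff_armPairGluing_and_boxRestriction :
    PercHyperscalingGluing.BoxGluing ↔
      ((∃ C : ℝ, 0 < C ∧ ∀ n : ℕ, 1 ≤ n →
        ∑ x ∈ box 3 n, (bondPercolation (zdGraph 3) (criticalProbI 3)).real
            (DCT16.armEvent 0 n ∩ DCT16.armEvent x n) ≤
          C * ∑ x ∈ box 3 n, (bondPercolation (zdGraph 3) (criticalProbI 3)).real (openConn 0 x)) ∧
      (∃ C : ℝ, ∃ K : ℕ, 0 < C ∧ 1 ≤ K ∧ ∀ n : ℕ, 1 ≤ n →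
        ∑ x ∈ box 3 n, (bondPercolation (zdGraph 3) (criticalProbI 3)).real (openConn 0 x) ≤
          C * ∑ x ∈ box 3 n, (bondPercolation (zdGraph 3) (criticalProbI 3)).real
            (openConnIn ↑(box 3 (K * n)) 0 x))) :=
  ⟨fun h => ⟨armPairGluing_of_boxGluing h, boxRestriction_of_boxGluing h⟩,
    fun h => boxGluing_of_armPairGluing_of_boxRestriction h.1 h.2⟩

/-! ## §2 What the route's deciding theorem consumes: jump gluing -/

/-- **Crux ⟹ jump gluing**: `BoxGluing` gives `θ(p_c)² ≤ C |Λ_n|⁻¹ Σ_{x∈Λ_n} τ^{Λ_{Kn}}(0,x)` for all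
`n ≥ 1`, by `θ ≤ π_n` (`DCT16.theta_le_real_siteToBoundary`). [folklore] -/
theorem jumpGluing_of_boxGluing (h : PercHyperscalingGluing.BoxGluing) :
    ∃ C : ℝ, ∃ K : ℕ, 0 < C ∧ 1 ≤ K ∧ ∀ n : ℕ, 1 ≤ n →
      theta (zdGraph 3) 0 (criticalProbI 3) ^ 2 ≤
        C * ((box 3 n).card : ℝ)⁻¹ * ∑ x ∈ box 3 n,
          (bondPercolation (zdGraph 3) (criticalProbI 3)).real (openConnIn ↑(box 3 (K * n)) 0 x) := by
  obtain ⟨C, K, hC, hK, h⟩ := h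
  refine ⟨C, K, hC, hK, fun n hn => le_trans ?_ (h n hn)⟩
  exact pow_le_pow_left₀ measureReal_nonneg (DCT16.theta_le_real_siteToBoundary _ n) 2

/-- **Jump gluing is vacuous in the target world**: if `θ(p_c) = 0` it holds with `C = K = 1`.  (So, unlike
the crux, it carries no hyperscaling content when `θ(p_c) = 0`.) [folklore] -/
theorem jumpGluing_of_theta_eq_zero (h0 : theta (zdGraph 3) 0 (criticalProbI 3) = 0) :
    ∃ C : ℝ, ∃ K : ℕ, 0 < C ∧ 1 ≤ K ∧ ∀ n : ℕ, 1 ≤ n →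
      theta (zdGraph 3) 0 (criticalProbI 3) ^ 2 ≤
        C * ((box 3 n).card : ℝ)⁻¹ * ∑ x ∈ box 3 n,
          (bondPercolation (zdGraph 3) (criticalProbI 3)).real (openConnIn ↑(box 3 (K * n)) 0 x) := by
  refine ⟨1, 1, one_pos, le_rfl, fun n _ => ?_⟩
  rw [h0, sq, mul_zero, one_mul]
  exact mul_nonneg (inv_nonneg.2 (Nat.cast_nonneg _)) (Finset.sum_nonneg fun _ _ => measureReal_nonneg)

/-- **Cerf's X_D at `p_c` ⟹ jump gluing**: linear-scale in-box long-range order under `θ > 0`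
(`PercFiniteBoxLRO.LinearScaleLROOfTheta`, stmt-CriticalPhenomena-0855: `θ(p) > 0 ⟹ ∃ ρ > 0, K, ∀ n ≥ 1,
∀ x y ∈ Λ_n, ρ ≤ P_p(x ↔ y in Λ_{Kn})`) gives jump gluing with `C = 1/ρ` (and the same `K`, which is `≥ 1`
since `K = 0` would force `ρ ≤ P(0 ↔ e₁ in {0}) = 0`); when `θ(p_c) = 0` jump gluing is free. [folklore] -/
theorem jumpGluing_of_linearScaleLROOfTheta (hX : PercFiniteBoxLRO.LinearScaleLROOfTheta) :
    ∃ C : ℝ, ∃ K : ℕ, 0 < C ∧ 1 ≤ K ∧ ∀ n : ℕ, 1 ≤ n →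
      theta (zdGraph 3) 0 (criticalProbI 3) ^ 2 ≤
        C * ((box 3 n).card : ℝ)⁻¹ * ∑ x ∈ box 3 n,
          (bondPercolation (zdGraph 3) (criticalProbI 3)).real (openConnIn ↑(box 3 (K * n)) 0 x) := by
  rcases eq_or_lt_of_le (measureReal_nonneg : 0 ≤ theta (zdGraph 3) 0 (criticalProbI 3)) with h0 | hpos
  · exact jumpGluing_of_theta_eq_zero h0.symm
  obtain ⟨ρ, hρ, K, hXK⟩ := hX (criticalProbI 3) hpos
  set P : Measure (BondConfig (Site 3)) := bondPercolation (zdGraph 3) (criticalProbI 3) with hP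
  -- `K ≥ 1`: otherwise `Λ_{K·1} = {0}` and `e₁ ∈ Λ_1` is not joined to `0` inside `{0}`
  have hK : 1 ≤ K := by
    by_contra hK0
    have hK0' : K = 0 := by omega
    let e : Site 3 := Pi.single 0 1
    have he : e ∈ box 3 1 := by
      rw [mem_box]; intro i
      by_cases hi : i = 0
      · subst hi; simp [e]
      · simp [e, hi]
    have h := hXK 1 le_rfl 0 (zero_mem_box 3 1) e he
    rw [hK0', zero_mul] at h
    have hempty : openConnIn (↑(box 3 0) : Set (Site 3)) (0 : Site 3) e = ∅ := by
      ext ω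
      simp only [Set.mem_empty_iff_false, iff_false]
      intro hω
      obtain ⟨-, he0, -⟩ := hω
      rw [Finset.mem_coe, mem_box] at he0
      have := he0 0
      simp [e] at this
    rw [hempty, measureReal_empty] at h
    exact absurd h (not_le.2 hρ)
  refine ⟨1 / ρ, K, by positivity, hK, fun n hn => ?_⟩
  have hθ1 : theta (zdGraph 3) 0 (criticalProbI 3) ^ 2 ≤ 1 :=
    pow_le_one₀ measureReal_nonneg measureReal_le_one
  -- the average of `τ^{Λ_{Kn}}(0,x)` over `x ∈ Λ_n` is at least `ρ`
  have havg : ρ * ((box 3 n).card : ℝ) ≤ ∑ x ∈ box 3 n, P.real (openConnIn ↑(box 3 (K * n)) 0 x) := by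
    calc ρ * ((box 3 n).card : ℝ) = ∑ _x ∈ box 3 n, ρ := by rw [Finset.sum_const, nsmul_eq_mul, mul_comm]
      _ ≤ ∑ x ∈ box 3 n, P.real (openConnIn ↑(box 3 (K * n)) 0 x) :=
          Finset.sum_le_sum fun x hx => hXK n hn 0 (zero_mem_box 3 n) x hx
  have hcard := FreeBoxSparse.Negative.card_box_pos' n
  calc theta (zdGraph 3) 0 (criticalProbI 3) ^ 2 ≤ 1 := hθ1
    _ = 1 / ρ * ((box 3 n).card : ℝ)⁻¹ * (ρ * ((box 3 n).card : ℝ)) := by field_simp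
    _ ≤ 1 / ρ * ((box 3 n).card : ℝ)⁻¹ * ∑ x ∈ box 3 n, P.real (openConnIn ↑(box 3 (K * n)) 0 x) :=
        mul_le_mul_of_nonneg_left havg (by positivity)

/-- **Jump gluing suffices for the route**: jump gluing and free-box shattering
(`PercHyperscalingGluing.FreeBoxShattering`, stmt-CriticalPhenomena-4644) give `θ(p_c) = 0` on `ℤ³` — the same
bookkeeping as the deciding theorem `PercHyperscalingGluing.closes`, with `θ` in place of `π_n` from the start:
`θ² ≤ C |Λ_n|⁻¹ Σ_{x∈Λ_n} τ^{Λ_{Kn}}(0,x) ≤ C |Λ_n|⁻¹ Σ_{x∈Λ_{Kn}} τ^{Λ_{Kn}}(0,x) = C (|Λ_{Kn}|/|Λ_n|) F_{Kn}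
≤ C K³ F_{Kn} → 0`. [folklore] -/
theorem percolationContinuityZ3_of_jumpGluing_of_freeBoxShattering
    (hJ : ∃ C : ℝ, ∃ K : ℕ, 0 < C ∧ 1 ≤ K ∧ ∀ n : ℕ, 1 ≤ n →
      theta (zdGraph 3) 0 (criticalProbI 3) ^ 2 ≤
        C * ((box 3 n).card : ℝ)⁻¹ * ∑ x ∈ box 3 n,
          (bondPercolation (zdGraph 3) (criticalProbI 3)).real (openConnIn ↑(box 3 (K * n)) 0 x))
    (hF : PercHyperscalingGluing.FreeBoxShattering) : _root_.PercolationContinuityZ3 := by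
  obtain ⟨C, K, hC, hK, hJn⟩ := hJ
  show theta (zdGraph 3) 0 (criticalProbI 3) = 0
  set P : Measure (BondConfig (Site 3)) := bondPercolation (zdGraph 3) (criticalProbI 3) with hP
  set θ : ℝ := theta (zdGraph 3) 0 (criticalProbI 3) with hθ
  set F : ℕ → ℝ := fun r : ℕ => ((box 3 r).card : ℝ)⁻¹ *
      ∑ x ∈ box 3 r, P.real (openConnIn ↑(box 3 r) 0 x) with hFdef
  have hF' : Tendsto F atTop (𝓝 0) := hF
  have hcardf : ∀ L : ℕ, ((box 3 L).card : ℝ) = (2 * (L : ℝ) + 1) ^ 3 := by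
    intro L; rw [card_box]; push_cast; ring
  -- the finite-n inequality θ² ≤ C K³ F(Kn)
  have key : ∀ n : ℕ, 1 ≤ n → θ ^ 2 ≤ C * (K : ℝ) ^ 3 * F (K * n) := by
    intro n hn
    have h2 := hJn n hn
    have hsub : box 3 n ⊆ box 3 (K * n) := box_mono 3 (le_mul_of_one_le_left (Nat.zero_le n) hK)
    have h3 : ∑ x ∈ box 3 n, P.real (openConnIn ↑(box 3 (K * n)) 0 x)
        ≤ ∑ x ∈ box 3 (K * n), P.real (openConnIn ↑(box 3 (K * n)) 0 x) :=
      Finset.sum_le_sum_of_subset_of_nonneg hsub fun _ _ _ => measureReal_nonneg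
    have h4 : ∑ x ∈ box 3 (K * n), P.real (openConnIn ↑(box 3 (K * n)) 0 x)
        = ((box 3 (K * n)).card : ℝ) * F (K * n) := by
      simp only [hFdef]
      rw [← mul_assoc, mul_inv_cancel₀ (FreeBoxSparse.Negative.card_box_pos' (K * n)).ne', one_mul]
    have hFn : 0 ≤ F (K * n) := by
      simp only [hFdef]
      exact mul_nonneg (inv_nonneg.2 (FreeBoxSparse.Negative.card_box_pos' _).le)
        (Finset.sum_nonneg fun _ _ => measureReal_nonneg)
    have hratio : ((box 3 (K * n)).card : ℝ) ≤ (K : ℝ) ^ 3 * ((box 3 n).card : ℝ) := by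
      rw [hcardf, hcardf, ← mul_pow]
      push_cast
      have hK1 : (1 : ℝ) ≤ K := by exact_mod_cast hK
      have hn0 : (0 : ℝ) ≤ n := Nat.cast_nonneg n
      apply pow_le_pow_left₀ (by positivity)
      nlinarith
    have ha := FreeBoxSparse.Negative.card_box_pos' n
    calc θ ^ 2 ≤ C * ((box 3 n).card : ℝ)⁻¹ * ∑ x ∈ box 3 n, P.real (openConnIn ↑(box 3 (K * n)) 0 x) := h2
      _ ≤ C * ((box 3 n).card : ℝ)⁻¹ * (((box 3 (K * n)).card : ℝ) * F (K * n)) := by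
          rw [← h4]
          exact mul_le_mul_of_nonneg_left h3 (mul_nonneg hC.le (inv_nonneg.2 ha.le))
      _ ≤ C * ((box 3 n).card : ℝ)⁻¹ * (((K : ℝ) ^ 3 * ((box 3 n).card : ℝ)) * F (K * n)) :=
          mul_le_mul_of_nonneg_left (mul_le_mul_of_nonneg_right hratio hFn)
            (mul_nonneg hC.le (inv_nonneg.2 ha.le))
      _ = C * (K : ℝ) ^ 3 * F (K * n) * (((box 3 n).card : ℝ)⁻¹ * ((box 3 n).card : ℝ)) := by ring
      _ = C * (K : ℝ) ^ 3 * F (K * n) := by rw [inv_mul_cancel₀ ha.ne', mul_one]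
  have hKn : Tendsto (fun n : ℕ => K * n) atTop atTop :=
    tendsto_atTop_mono (fun n => le_mul_of_one_le_left (Nat.zero_le n) hK) tendsto_id
  have hlim : Tendsto (fun n : ℕ => C * (K : ℝ) ^ 3 * F (K * n)) atTop (𝓝 0) := by
    have := (hF'.comp hKn).const_mul (C * (K : ℝ) ^ 3)
    simpa using this
  have hsq : θ ^ 2 ≤ 0 := ge_of_tendsto hlim (eventually_atTop.2 ⟨1, key⟩)
  exact pow_eq_zero_iff two_ne_zero |>.1 (le_antisymm hsq (sq_nonneg θ))

/-- **Cross-route corollary**: X_D (`LinearScaleLROOfTheta`, stmt-0855) and free-box shattering (stmt-4644)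
give `θ(p_c) = 0` through jump gluing — the route `PercHyperscalingGluing` re-targeted at what its assembly
consumes (cf. the support item `CerfShortcut`, stmt-4647, which reaches the same conclusion from the pointwise
X_D directly). [folklore] -/
theorem percolationContinuityZ3_of_linearScaleLROOfTheta_of_freeBoxShattering
    (hX : PercFiniteBoxLRO.LinearScaleLROOfTheta) (hF : PercHyperscalingGluing.FreeBoxShattering) :
    _root_.PercolationContinuityZ3 :=
  percolationContinuityZ3_of_jumpGluing_of_freeBoxShattering (jumpGluing_of_linearScaleLROOfTheta hX) hF

end Summit.CriticalPhenomena.PercolationContinuityZ3.Theorems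

end
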